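import Summits.CriticalPhenomena.PercolationContinuityZ3.Theorems.Transplant.GrigorchukLamplighterDefs
import Mathlib.GroupTheory.Perm.Basic
import Mathlib.Tactic.Group
import HarnessLib

/-!
# The LEVEL-ONE SECTIONS of the first Grigorchuk group: `ψ = (φ₀, φ₁) : St(1) → Perm × Perm`, the table `b = (a, c)`, `c = (a, d)`, `d = (1, b)`,
# `a x a = (x₁, x₀)`, injectivity of `ψ`, `St_𝔊(1) = ⟨b, c, d, aba, aca, ada⟩`, and: sections of elements of `St_𝔊(1)` lie in `𝔊`

builds on p205010 (kernel theorem, internal audit signed; external expert review pending) — nothing in this file uses p205010; pure group theory, no percolation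
statement, no node touched.  DEFINITIONS (`cons`, `tail`, `secFun`, `sec`) + their API, reproducing published structure of a published object (the tree's
`Grigorchuk.grigorchukGroup` of «GrigorchukLamplighterDefs» p581401, defined there by the CLOSED FORM of the generators on rays); citation tags on every result.
Lane `prim-bschramm`, seat `prim-bschramm-p3` gen 35 (DESIGN OWNER; `run/shared/lean/prim/bschramm/P3-NILPOTENT.md` §28.5–28.6, offer O8 = file F1 of the O7
plan, lead g25 GO 2026-08-28 00:30Z).  DEFINITION LANE (review-queued).  Helper file (`--supports stmt-CriticalPhenomena-4575 --as helper`).  No instance, no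
notation.  Group theory of `𝔊` (Grigorchuk 1980): the level-one sections of the tree's `𝔊` — infrastructure for O7 (Grigorchuk's torsion theorem, used only to
discharge the binder `htor` of «GrigorchukLamplighterStandardGensNoGo» p589680), for level-transitivity / `|X| = ∞`, and for any later `𝔊` item.  NOTHING about
growth or amenability of `𝔊` is claimed anywhere; no torsion statement in THIS file.

* §1 `cons i y` (prepend a letter), `tail x` (drop the first letter) and their algebra with `flipAt`.
* §2 THE GENERATORS ON PREPENDED RAYS (the wreath recursion recovered from the closed form): `genA (i·y) = (¬i)·y`; `genB (1·y) = 1·genC y`,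
  `genC (1·y) = 1·genD y`, `genD (1·y) = 1·genB y` (the pattern of `b` shifted by one letter IS the pattern of `c`, etc.); `genB (0·y) = 0·genA y`,
  `genC (0·y) = 0·genA y`, `genD (0·y) = 0·y`.
* §3 SECTIONS: for `g ∈ stabOne` (first-letter preserving permutations) the section `sec i g ∈ Perm(Ray)`, `(sec i g) y = tail (g (i·y))`, a homomorphism
  `sec i : stabOne →* Perm(Ray)`; `g (i·y) = i·(sec i g y)`; `ψ = (sec 0, sec 1)` is injective (`eq_of_sec_eq`).
* §4 THE TABLE: `sec₀ b = a`, `sec₁ b = c`, `sec₀ c = a`, `sec₁ c = d`, `sec₀ d = 1`, `sec₁ d = b`; conjugation by `a` preserves `stabOne` and swaps the sections.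
* §5 `St_𝔊(1) = stabOne ⊓ 𝔊 = ⟨b, c, d, aba, aca, ada⟩` (parity-of-`a` closure induction) and **sections of elements of `St_𝔊(1)` lie in `𝔊`** (`sec_mem_grigorchukGroup`).
[cite: Grigorchuk1980, definition of a, b, c, d and the relations b = (a, c), c = (a, d), d = (1, b)] [cite: BartholdiErschler2012, §3.1 (the first Grigorchuk group,
wreath recursion, St(1))]
-/

noncomputable section

namespace Summit.CriticalPhenomena.PercolationContinuityZ3.Theorems.Transplant

namespace Grigorchuk

open scoped Classical

/-! ## §1 Prepending a letter; the tail of a ray -/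

/-- Prepend the letter `i` to the ray `y`: the ray `i y₀ y₁ …`. [cite: BartholdiErschler2012, §3 (words and rays)] -/
def cons (i : Bool) (y : Ray) : Ray := fun n => Nat.rec i (fun m _ => y m) n

/-- Drop the first letter: the ray `x₁ x₂ …`. [cite: BartholdiErschler2012, §3 (words and rays)] -/
def tail (x : Ray) : Ray := fun n => x (n + 1)

/-- `(i·y)₀ = i`. [folklore] -/
@[simp] theorem cons_zero (i : Bool) (y : Ray) : cons i y 0 = i := rfl
/-- `(i·y)ₙ₊₁ = yₙ`. [folklore] -/
@[simp] theorem cons_succ (i : Bool) (y : Ray) (n : ℕ) : cons i y (n + 1) = y n := rfl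
/-- `(tail x)ₙ = xₙ₊₁`. [folklore] -/
@[simp] theorem tail_apply (x : Ray) (n : ℕ) : tail x n = x (n + 1) := rfl
/-- `tail (i·y) = y`. [folklore] -/
@[simp] theorem tail_cons (i : Bool) (y : Ray) : tail (cons i y) = y := rfl

/-- A ray is its first letter prepended to its tail. [folklore] -/
theorem cons_head_tail (x : Ray) : cons (x 0) (tail x) = x := by
  funext n; cases n <;> rfl

/-- `cons i` is injective. [folklore] -/
theorem cons_injective (i : Bool) : Function.Injective (cons i) := fun y y' h => by
  rw [← tail_cons i y, h, tail_cons]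
/-- Flipping letter `0` of `i·y` flips `i`. [folklore] -/
theorem flipAt_zero_cons (i : Bool) (y : Ray) : flipAt 0 (cons i y) = cons (!i) y := by
  funext n; cases n <;> simp [flipAt]

/-- Flipping letter `n+1` of `i·y` flips letter `n` of `y`. [folklore] -/
theorem flipAt_succ_cons (n : ℕ) (i : Bool) (y : Ray) : flipAt (n + 1) (cons i y) = cons i (flipAt n y) := by
  funext m
  cases m with
  | zero => simp [flipAt]
  | succ m =>
    by_cases h : m = n
    · subst h; simp [flipAt]
    · simp [flipAt, h]

/-! ## §2 The generators on prepended rays (the wreath recursion `a = σ`, `b = (a, c)`, `c = (a, d)`, `d = (1, b)`) -/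

/-- `a (i·y) = (¬i)·y`. [cite: Grigorchuk1980, definition of a] -/
theorem genA_cons (i : Bool) (y : Ray) : genA (cons i y) = cons (!i) y := by
  rw [genA_apply, flipAt_zero_cons]

/-- The ray `1·y` has a letter `0` iff `y` does, one position later. [folklore] -/
theorem find_cons_true {y : Ray} (h' : ∃ k, y k = false) (h : ∃ k, cons true y k = false) : Nat.find h = Nat.find h' + 1 := by
  rw [Nat.find_eq_iff]
  refine ⟨by simpa using Nat.find_spec h', fun n hn => ?_⟩
  cases n with
  | zero => simp
  | succ m =>
    have hm : m < Nat.find h' := by omega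
    simpa using Nat.find_min h' hm

/-- **The section generators on `1·y`: the pattern shifts by one letter.** [cite: Grigorchuk1980, relations b = (a,c), c = (a,d), d = (1,b)] -/
theorem sectionGen_cons_true (P : ℕ → Bool) (y : Ray) : sectionGen P (cons true y) = cons true (sectionGen (fun k => P (k + 1)) y) := by
  unfold sectionGen
  by_cases h' : ∃ k, y k = false
  · have h : ∃ k, cons true y k = false := by obtain ⟨k, hk⟩ := h'; exact ⟨k + 1, by simpa using hk⟩
    rw [dif_pos h, dif_pos h', find_cons_true h' h]
    by_cases hP : P (Nat.find h' + 1) = true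
    · rw [if_pos hP, if_pos hP, flipAt_succ_cons]
    · rw [if_neg hP, if_neg hP]
  · have h : ¬ ∃ k, cons true y k = false := by
      rintro ⟨k, hk⟩
      cases k with
      | zero => simp at hk
      | succ m => exact h' ⟨m, by simpa using hk⟩
    rw [dif_neg h, dif_neg h']

/-- **The section generators on `0·y`: act on the first letter of `y` (by `a`) iff the pattern holds at `0`.** [cite: Grigorchuk1980, relations b = (a,c), c = (a,d), d = (1,b)] -/
theorem sectionGen_cons_false (P : ℕ → Bool) (y : Ray) : sectionGen P (cons false y) = cons false (if P 0 then flipAt 0 y else y) := by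
  unfold sectionGen
  have h : ∃ k, cons false y k = false := ⟨0, rfl⟩
  have h0 : Nat.find h = 0 := by rw [Nat.find_eq_zero]; rfl
  rw [dif_pos h, h0]
  by_cases hP : P 0 = true
  · rw [if_pos hP, if_pos hP, show (0 : ℕ) + 1 = 1 from rfl, flipAt_succ_cons]
  · rw [if_neg hP, if_neg hP]

/-- `b (1·y) = 1·(c y)`. [cite: Grigorchuk1980, relation b = (a, c)] -/
theorem genB_cons_true (y : Ray) : genB (cons true y) = cons true (genC y) := by
  rw [genB_apply, sectionGen_cons_true, genC_apply]
  congr 2; funext k; simp only [decide_eq_decide]; omega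

/-- `c (1·y) = 1·(d y)`. [cite: Grigorchuk1980, relation c = (a, d)] -/
theorem genC_cons_true (y : Ray) : genC (cons true y) = cons true (genD y) := by
  rw [genC_apply, sectionGen_cons_true, genD_apply]
  congr 2; funext k; simp only [decide_eq_decide]; omega

/-- `d (1·y) = 1·(b y)`. [cite: Grigorchuk1980, relation d = (1, b)] -/
theorem genD_cons_true (y : Ray) : genD (cons true y) = cons true (genB y) := by
  rw [genD_apply, sectionGen_cons_true, genB_apply]
  congr 2; funext k; simp only [decide_eq_decide]; omega

/-- `b (0·y) = 0·(a y)`. [cite: Grigorchuk1980, relation b = (a, c)] -/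
theorem genB_cons_false (y : Ray) : genB (cons false y) = cons false (genA y) := by
  rw [genB_apply, sectionGen_cons_false, genA_apply]; simp

/-- `c (0·y) = 0·(a y)`. [cite: Grigorchuk1980, relation c = (a, d)] -/
theorem genC_cons_false (y : Ray) : genC (cons false y) = cons false (genA y) := by
  rw [genC_apply, sectionGen_cons_false, genA_apply]; simp

/-- `d (0·y) = 0·y`. [cite: Grigorchuk1980, relation d = (1, b)] -/
theorem genD_cons_false (y : Ray) : genD (cons false y) = cons false y := by
  rw [genD_apply, sectionGen_cons_false]; simp

/-! ## §3 Sections of a first-letter-preserving permutation -/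

/-- The section of `g` at the letter `i`, as a function: `y ↦ tail (g (i·y))`. [cite: BartholdiErschler2012, §3.1 (wreath recursion / sections)] -/
def secFun (i : Bool) (g : Equiv.Perm Ray) (y : Ray) : Ray := tail (g (cons i y))

/-- For `g ∈ stabOne`: `g (i·y) = i·(secFun i g y)`. [cite: BartholdiErschler2012, §3.1] -/
theorem cons_secFun {g : Equiv.Perm Ray} (hg : g ∈ stabOne) (i : Bool) (y : Ray) : cons i (secFun i g y) = g (cons i y) := by
  have h0 : g (cons i y) 0 = i := by rw [mem_stabOne.1 hg]; rfl
  have e := cons_head_tail (g (cons i y))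
  rw [h0] at e
  exact e

/-- Sections compose: `secFun i (g h) = secFun i g ∘ secFun i h` on `stabOne`. [cite: BartholdiErschler2012, §3.1] -/
theorem secFun_mul {g h : Equiv.Perm Ray} (hh : h ∈ stabOne) (i : Bool) (y : Ray) :
    secFun i (g * h) y = secFun i g (secFun i h y) := by
  rw [secFun, secFun, Equiv.Perm.mul_apply, ← cons_secFun hh]

/-- `secFun i g⁻¹` inverts `secFun i g` on `stabOne`. [folklore] -/
theorem secFun_inv_apply {g : Equiv.Perm Ray} (hg : g ∈ stabOne) (i : Bool) (y : Ray) : secFun i g⁻¹ (secFun i g y) = y := by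
  rw [← secFun_mul hg, inv_mul_cancel, secFun, Equiv.Perm.one_apply, tail_cons]

/-- **The section homomorphism `sec i : stabOne → Perm(Ray)`** (`φᵢ` of the wreath recursion `ψ = (φ₀, φ₁)`).
[cite: Grigorchuk1980, the recursive definition of b, c, d] [cite: BartholdiErschler2012, §3.1 (ψ : St(1) → G × G)] -/
def sec (i : Bool) : ↥stabOne →* Equiv.Perm Ray where
  toFun g :=
    { toFun := secFun i (g : Equiv.Perm Ray)
      invFun := secFun i ((g : Equiv.Perm Ray)⁻¹)
      left_inv := fun y => secFun_inv_apply g.2 i y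
      right_inv := fun y => by simpa using secFun_inv_apply (stabOne.inv_mem g.2) i y }
  map_one' := by ext y n; simp [secFun]
  map_mul' g h := by ext y n; simp [secFun_mul h.2]

/-- Unfolding `sec`. [folklore] -/
theorem sec_apply (i : Bool) (g : ↥stabOne) (y : Ray) : sec i g y = tail ((g : Equiv.Perm Ray) (cons i y)) := rfl

/-- **`g (i·y) = i·(sec i g y)`** for `g ∈ St(1)`. [cite: BartholdiErschler2012, §3.1] -/
theorem apply_cons (g : ↥stabOne) (i : Bool) (y : Ray) : (g : Equiv.Perm Ray) (cons i y) = cons i (sec i g y) :=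
  (cons_secFun g.2 i y).symm

/-- **`ψ = (sec 0, sec 1)` is injective on `St(1)`**: a first-letter-preserving permutation is determined by its two sections. [cite: BartholdiErschler2012, §3.1 (ψ is injective)] -/
theorem eq_of_sec_eq {g h : ↥stabOne} (h0 : sec false g = sec false h) (h1 : sec true g = sec true h) : g = h := by
  refine Subtype.ext (Equiv.ext fun x => ?_)
  rw [← cons_head_tail x]
  cases x 0
  · rw [apply_cons, apply_cons, h0]
  · rw [apply_cons, apply_cons, h1]

/-! ## §4 The table of sections of the generators -/

/-- `b` as an element of `St(1)`. [cite: BartholdiErschler2012, §3.1] -/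
def bSt : ↥stabOne := ⟨genB, genB_mem_stabOne⟩
/-- `c` as an element of `St(1)`. [cite: BartholdiErschler2012, §3.1] -/
def cSt : ↥stabOne := ⟨genC, genC_mem_stabOne⟩
/-- `d` as an element of `St(1)`. [cite: BartholdiErschler2012, §3.1] -/
def dSt : ↥stabOne := ⟨genD, genD_mem_stabOne⟩
/-- **`ψ(b) = (a, c)`.** [cite: Grigorchuk1980, relation b = (a, c)] -/
theorem sec_bSt : sec false bSt = genA ∧ sec true bSt = genC := by
  constructor
  · ext y n; change tail (genB (cons false y)) n = _; rw [genB_cons_false, tail_cons]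
  · ext y n; change tail (genB (cons true y)) n = _; rw [genB_cons_true, tail_cons]

/-- **`ψ(c) = (a, d)`.** [cite: Grigorchuk1980, relation c = (a, d)] -/
theorem sec_cSt : sec false cSt = genA ∧ sec true cSt = genD := by
  constructor
  · ext y n; change tail (genC (cons false y)) n = _; rw [genC_cons_false, tail_cons]
  · ext y n; change tail (genC (cons true y)) n = _; rw [genC_cons_true, tail_cons]

/-- **`ψ(d) = (1, b)`.** [cite: Grigorchuk1980, relation d = (1, b)] -/
theorem sec_dSt : sec false dSt = 1 ∧ sec true dSt = genB := by
  constructor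
  · ext y n; change tail (genD (cons false y)) n = _; rw [genD_cons_false, tail_cons]; rfl
  · ext y n; change tail (genD (cons true y)) n = _; rw [genD_cons_true, tail_cons]

/-- `a² = 1` (local copy of «GrigorchukLamplighterCriticalContinuity» `genA_mul_genA`, to keep this defs file's imports light). [cite: Grigorchuk1980, a is an involution] -/
private theorem genA_sq : genA * genA = 1 := Equiv.ext fun x => flipAt_involutive 0 x

/-- `a⁻¹ = a` (local copy). [cite: Grigorchuk1980, a is an involution] -/
private theorem genA_inv' : genA⁻¹ = genA := inv_eq_of_mul_eq_one_right genA_sq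

/-- Conjugation by `a` preserves `St(1)`. [cite: BartholdiErschler2012, §3.1 (St(1) is normal)] -/
theorem conj_genA_mem_stabOne {g : Equiv.Perm Ray} (hg : g ∈ stabOne) : genA * g * genA ∈ stabOne := by
  intro x
  rw [Equiv.Perm.mul_apply, Equiv.Perm.mul_apply, genA_apply_zero, mem_stabOne.1 hg, genA_apply_zero, Bool.not_not]

/-- **`ψ(a g a) = (g₁, g₀)`: conjugation by `a` swaps the sections.** [cite: BartholdiErschler2012, §3.1 (ψ(aga) = σψ(g))] -/
theorem sec_conj_genA (g : ↥stabOne) (i : Bool) :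
    sec i ⟨genA * (g : Equiv.Perm Ray) * genA, conj_genA_mem_stabOne g.2⟩ = sec (!i) g := by
  ext y n
  change tail ((genA * (g : Equiv.Perm Ray) * genA) (cons i y)) n = tail ((g : Equiv.Perm Ray) (cons (!i) y)) n
  rw [Equiv.Perm.mul_apply, Equiv.Perm.mul_apply, genA_cons, apply_cons, genA_cons, Bool.not_not, tail_cons, tail_cons]

/-! ## §5 `St_𝔊(1) = ⟨b, c, d, aba, aca, ada⟩`; sections of its elements lie in `𝔊` -/

/-- The six Reidemeister–Schreier generators of `St_𝔊(1)` (standard; the index-two subgroup of words with an even number of `a`'s). [folklore]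
[cite: Grigorchuk1980, the subgroup St(1) of elements fixing the first level] -/
def stabOneGens : Set (Equiv.Perm Ray) := {genB, genC, genD, genA * genB * genA, genA * genC * genA, genA * genD * genA}

/-- The six generators lie in `𝔊`. [cite: BartholdiErschler2012, §3.1] -/
theorem stabOneGens_subset_grigorchukGroup : stabOneGens ⊆ (grigorchukGroup : Set (Equiv.Perm Ray)) := by
  have ha : genA ∈ grigorchukGroup := Subgroup.subset_closure (by simp)
  have hb : genB ∈ grigorchukGroup := Subgroup.subset_closure (by simp)
  have hc : genC ∈ grigorchukGroup := Subgroup.subset_closure (by simp)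
  have hd : genD ∈ grigorchukGroup := Subgroup.subset_closure (by simp)
  rintro x hx
  simp only [stabOneGens, Set.mem_insert_iff, Set.mem_singleton_iff] at hx
  rcases hx with rfl | rfl | rfl | rfl | rfl | rfl
  · exact hb
  · exact hc
  · exact hd
  · exact grigorchukGroup.mul_mem (grigorchukGroup.mul_mem ha hb) ha
  · exact grigorchukGroup.mul_mem (grigorchukGroup.mul_mem ha hc) ha
  · exact grigorchukGroup.mul_mem (grigorchukGroup.mul_mem ha hd) ha

/-- The six generators lie in `St(1)`. [cite: BartholdiErschler2012, §3.1] -/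
theorem stabOneGens_subset_stabOne : stabOneGens ⊆ (stabOne : Set (Equiv.Perm Ray)) := by
  rintro x hx
  simp only [stabOneGens, Set.mem_insert_iff, Set.mem_singleton_iff] at hx
  rcases hx with rfl | rfl | rfl | rfl | rfl | rfl
  · exact genB_mem_stabOne
  · exact genC_mem_stabOne
  · exact genD_mem_stabOne
  · exact conj_genA_mem_stabOne genB_mem_stabOne
  · exact conj_genA_mem_stabOne genC_mem_stabOne
  · exact conj_genA_mem_stabOne genD_mem_stabOne

/-- Conjugation by `a` preserves `⟨b, c, d, aba, aca, ada⟩`. [cite: BartholdiErschler2012, §3.1] -/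
theorem conj_genA_mem_closure_stabOneGens {k : Equiv.Perm Ray} (hk : k ∈ Subgroup.closure stabOneGens) :
    genA * k * genA ∈ Subgroup.closure stabOneGens := by
  induction hk using Subgroup.closure_induction with
  | mem x hx =>
    have e : ∀ z : Equiv.Perm Ray, genA * (genA * z * genA) * genA = z := fun z => by
      rw [← mul_assoc, ← mul_assoc, genA_sq, one_mul, mul_assoc, genA_sq, mul_one]
    simp only [stabOneGens, Set.mem_insert_iff, Set.mem_singleton_iff] at hx
    rcases hx with rfl | rfl | rfl | rfl | rfl | rfl <;> first
      | (rw [e]; exact Subgroup.subset_closure (by simp [stabOneGens]))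
      | exact Subgroup.subset_closure (by simp [stabOneGens])
  | one => rw [mul_one, genA_sq]; exact Subgroup.one_mem _
  | mul x y _ _ hx hy =>
    have e : genA * (x * y) * genA = (genA * x * genA) * (genA * y * genA) := by
      rw [show genA * (x * y) * genA = genA * x * (genA * genA) * y * genA by rw [genA_sq]; group]; group
    rw [e]; exact Subgroup.mul_mem _ hx hy
  | inv x _ hx =>
    have e : genA * x⁻¹ * genA = (genA * x * genA)⁻¹ := by
      rw [mul_inv_rev, mul_inv_rev, genA_inv', mul_assoc]
    rw [e]; exact Subgroup.inv_mem _ hx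

/-- Every element of `𝔊` is in `⟨b, c, d, aba, aca, ada⟩` or in its coset by `a`. [folklore] [cite: BartholdiErschler2012, §3.1 ([𝔊 : St(1)] = 2)] -/
theorem mem_closure_stabOneGens_or {g : Equiv.Perm Ray} (hg : g ∈ grigorchukGroup) :
    g ∈ Subgroup.closure stabOneGens ∨ g * genA ∈ Subgroup.closure stabOneGens := by
  induction hg using Subgroup.closure_induction with
  | mem x hx =>
    simp only [Set.mem_insert_iff, Set.mem_singleton_iff] at hx
    rcases hx with rfl | rfl | rfl | rfl
    · right; rw [genA_sq]; exact Subgroup.one_mem _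
    · left; exact Subgroup.subset_closure (by simp [stabOneGens])
    · left; exact Subgroup.subset_closure (by simp [stabOneGens])
    · left; exact Subgroup.subset_closure (by simp [stabOneGens])
  | one => left; exact Subgroup.one_mem _
  | mul x y _ _ hx hy =>
    rcases hx with hx | hx <;> rcases hy with hy | hy
    · left; exact Subgroup.mul_mem _ hx hy
    · right; rw [mul_assoc]; exact Subgroup.mul_mem _ hx hy
    · -- `x = k a`, `y ∈ K`: `x y = k (a y a) a`
      right
      have e : x * y * genA = (x * genA) * (genA * y * genA) := by
        rw [show x * genA * (genA * y * genA) = x * (genA * genA) * y * genA by group, genA_sq]; group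
      rw [e]; exact Subgroup.mul_mem _ hx (conj_genA_mem_closure_stabOneGens hy)
    · left
      have e : x * y = (x * genA) * (genA * (y * genA) * genA) := by
        rw [show x * genA * (genA * (y * genA) * genA) = x * (genA * genA) * y * (genA * genA) by group, genA_sq]; group
      rw [e]; exact Subgroup.mul_mem _ hx (conj_genA_mem_closure_stabOneGens hy)
  | inv x _ hx =>
    rcases hx with hx | hx
    · left; exact Subgroup.inv_mem _ hx
    · right
      have e : genA * (x * genA)⁻¹ * genA = x⁻¹ * genA := by
        rw [mul_inv_rev, genA_inv', ← mul_assoc, genA_sq, one_mul]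
      rw [← e]; exact conj_genA_mem_closure_stabOneGens (Subgroup.inv_mem _ hx)

/-- **`St_𝔊(1) = stabOne ⊓ 𝔊 = ⟨b, c, d, aba, aca, ada⟩`** (Reidemeister–Schreier for the index-two subgroup). [folklore]
[cite: Grigorchuk1980, the subgroup St(1) of elements fixing the first level] -/
theorem stabOne_inf_grigorchukGroup : stabOne ⊓ grigorchukGroup = Subgroup.closure stabOneGens := by
  refine le_antisymm ?_ ?_
  · rintro g ⟨hg1, hgG⟩
    rcases mem_closure_stabOneGens_or hgG with h | h
    · exact h
    · exfalso
      -- then `a = g⁻¹ (g a) ∈ St(1)`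
      have hK : Subgroup.closure stabOneGens ≤ stabOne := (Subgroup.closure_le _).2 stabOneGens_subset_stabOne
      have : genA ∈ stabOne := by
        have h2 := stabOne.mul_mem (stabOne.inv_mem hg1) (hK h)
        rwa [← mul_assoc, inv_mul_cancel, one_mul] at h2
      exact genA_not_mem_stabOne this
  · rw [Subgroup.closure_le]
    exact fun x hx => ⟨stabOneGens_subset_stabOne hx, stabOneGens_subset_grigorchukGroup hx⟩

/-- **Sections of elements of `St_𝔊(1)` lie in `𝔊`** (`ψ : St_𝔊(1) → 𝔊 × 𝔊`). [cite: BartholdiErschler2012, §3.1 (ψ : St(1) → G × G)]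
[cite: Grigorchuk1980, relations b = (a,c), c = (a,d), d = (1,b)] -/
theorem sec_mem_grigorchukGroup (g : ↥stabOne) (hg : (g : Equiv.Perm Ray) ∈ grigorchukGroup) (i : Bool) : sec i g ∈ grigorchukGroup := by
  have hK : (g : Equiv.Perm Ray) ∈ Subgroup.closure stabOneGens := by
    rw [← stabOne_inf_grigorchukGroup]; exact ⟨g.2, hg⟩
  -- induction over the six generators, carrying the `stabOne` membership proof along
  suffices h : ∀ k ∈ Subgroup.closure stabOneGens, ∀ hk : k ∈ stabOne, ∀ j : Bool, sec j ⟨k, hk⟩ ∈ grigorchukGroup from h _ hK g.2 i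
  intro k hk
  induction hk using Subgroup.closure_induction with
  | mem x hx =>
    intro hx1 j
    have ha : genA ∈ grigorchukGroup := Subgroup.subset_closure (by simp)
    have hb : genB ∈ grigorchukGroup := Subgroup.subset_closure (by simp)
    have hc : genC ∈ grigorchukGroup := Subgroup.subset_closure (by simp)
    have hd : genD ∈ grigorchukGroup := Subgroup.subset_closure (by simp)
    simp only [stabOneGens, Set.mem_insert_iff, Set.mem_singleton_iff] at hx
    rcases hx with rfl | rfl | rfl | rfl | rfl | rfl
    · cases j
      · rw [show (⟨genB, hx1⟩ : ↥stabOne) = bSt from rfl, sec_bSt.1]; exact ha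
      · rw [show (⟨genB, hx1⟩ : ↥stabOne) = bSt from rfl, sec_bSt.2]; exact hc
    · cases j
      · rw [show (⟨genC, hx1⟩ : ↥stabOne) = cSt from rfl, sec_cSt.1]; exact ha
      · rw [show (⟨genC, hx1⟩ : ↥stabOne) = cSt from rfl, sec_cSt.2]; exact hd
    · cases j
      · rw [show (⟨genD, hx1⟩ : ↥stabOne) = dSt from rfl, sec_dSt.1]; exact grigorchukGroup.one_mem
      · rw [show (⟨genD, hx1⟩ : ↥stabOne) = dSt from rfl, sec_dSt.2]; exact hb
    · rw [show (⟨genA * genB * genA, hx1⟩ : ↥stabOne) = ⟨genA * (bSt : Equiv.Perm Ray) * genA, conj_genA_mem_stabOne bSt.2⟩ from rfl,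
        sec_conj_genA bSt]
      cases j
      · rw [Bool.not_false, sec_bSt.2]; exact hc
      · rw [Bool.not_true, sec_bSt.1]; exact ha
    · rw [show (⟨genA * genC * genA, hx1⟩ : ↥stabOne) = ⟨genA * (cSt : Equiv.Perm Ray) * genA, conj_genA_mem_stabOne cSt.2⟩ from rfl,
        sec_conj_genA cSt]
      cases j
      · rw [Bool.not_false, sec_cSt.2]; exact hd
      · rw [Bool.not_true, sec_cSt.1]; exact ha
    · rw [show (⟨genA * genD * genA, hx1⟩ : ↥stabOne) = ⟨genA * (dSt : Equiv.Perm Ray) * genA, conj_genA_mem_stabOne dSt.2⟩ from rfl,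
        sec_conj_genA dSt]
      cases j
      · rw [Bool.not_false, sec_dSt.2]; exact hb
      · rw [Bool.not_true, sec_dSt.1]; exact grigorchukGroup.one_mem
  | one => intro hk1 j; rw [show (⟨1, hk1⟩ : ↥stabOne) = 1 from rfl, map_one]; exact grigorchukGroup.one_mem
  | mul x y hx hy ihx ihy =>
    intro hk1 j
    have hK : Subgroup.closure stabOneGens ≤ stabOne := (Subgroup.closure_le _).2 stabOneGens_subset_stabOne
    rw [show (⟨x * y, hk1⟩ : ↥stabOne) = ⟨x, hK hx⟩ * ⟨y, hK hy⟩ from rfl, map_mul]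
    exact grigorchukGroup.mul_mem (ihx (hK hx) j) (ihy (hK hy) j)
  | inv x hx ihx =>
    intro hk1 j
    have hK : Subgroup.closure stabOneGens ≤ stabOne := (Subgroup.closure_le _).2 stabOneGens_subset_stabOne
    rw [show (⟨x⁻¹, hk1⟩ : ↥stabOne) = ⟨x, hK hx⟩⁻¹ from rfl, map_inv]
    exact grigorchukGroup.inv_mem (ihx (hK hx) j)

end Grigorchuk

end Summit.CriticalPhenomena.PercolationContinuityZ3.Theorems.Transplant

end
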